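import Summits.FinalStateConjecture.FinalStateConjecture.Theorems.PhotonSphereChannelsDarkFutureDefs
import Summits.FinalStateConjecture.FinalStateConjecture.Theorems.PhotonSphereChannelsChannelsResolveTameDevelopmentsRPinnedClopenLocus
import Summits.FinalStateConjecture.FinalStateConjecture.Theorems.PhotonSphereChannelsChannelsResolveTameDevelopmentsRGlobalCloseness
import HarnessLib

/-!
# Route PhotonSphereChannels · crux `ChannelsResolveTameDevelopmentsR` (K2R-T2, stmt-FinalStateConjecture-17430) —
# the reduction of stub K `stub_kerrLocusClopen` (line `dark-future-exactness`) to a HULL TOPOLOGY and PINNING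
# along a horizon generator path

Stub K of the skeleton `Cruxes/ChannelsResolveTameDevelopmentsR/Lines/dark_future_exactness.lean` (the ∀→∃ conversion):
for a development as in Φ, a class `(Λ, r₀)`, window isolation along generators and a horizon generator path `γ`, if SOME
horizon-hull element along `γ` (`TameHull.IsHorizonHullElement`) has domain of outer communications exactly Kerr `(M, a)`
(sub-extremal), then ONE sub-extremal `(M, a)` serves ALL horizon-hull elements along `γ`. Its intended proof is point-set
topology on the based hull `Ω_γ` (landed in abstract form: `HullTopology.subset_locus_of_finitePinning`,
`…RPinnedClopenLocus.lean`) fed by four geometric inputs. This file types those inputs as PARAMETRISED predicates over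
the landed vocabulary (`…Theorems.PhotonSphereChannelsDarkFutureDefs`) and proves K's text from them, kernel-checked:

* §1 `HullElt 𝒟 Λ r₀ γ` — the based hull `Ω_γ` as a type (triples `(𝓢, E, p)` with `IsHorizonHullElement 𝒟 Λ r₀ γ 𝓢 E p`);
  `HullTopologyAlong 𝒟 Λ r₀ γ` (B1–B3) — SOME topology on `Ω_γ` which is (B1) preconnected, in which (B2) every
  sub-extremal Kerr locus `{Z | IsKerrDoc Z.𝓢 Z.E.doc M a}` is closed, and in which (B3) every exterior-window-closeness set
  `{Z | IsExteriorWindowClose Z.𝓢 Z.E M a W η δ}` (`0 < η`, `0 < δ`) is a neighbourhood of every exactly-Kerr-`(M, a)`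
  element; `KerrParametersPinnedAlong 𝒟 Λ r₀ γ` (B4) — the sub-extremal parameters realised as exact Kerr d.o.c.s on `Ω_γ`
  form a finite set (area theorem / mass budget; topology-free).
* §2 `isKerrDoc_along_of_hullTopology` — (B1–B4) + `WindowIsolationAlong` (K's hypothesis, the (iso) input of the abstract
  lemma) + one exactly-Kerr-`(M, a)` element ⇒ EVERY element of `Ω_γ` is Kerr `(M, a)` (the witness's own parameters);
  `kerrLocus_along_of_hullTopology_of_pinned` — K's quantifier shape for one development and one path;
  `kerrLocusClopen_of_hullTopology_of_pinned` — K's registered text VERBATIM as conclusion, with "(B1–B3) ∧ (B4) for every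
  development as in Φ, class and horizon generator path" as the hypothesis (`GeneratorHullExists`, `DevHyp`, `0 < r₀` are
  handed to the producers of (B1)–(B4), not consumed by the logic).
* §3 The minimal gap of the pure-logic attempt on K (lead's `work/stubs/stub_kerrLocusClopen.md`, obstruction goals 1–2),
  typed: `OpennessTransportAlong 𝒟 Λ r₀ γ` (T) — window-closeness to the Kerr exterior of an exactly-Kerr element transported
  to EVERY element along the same `γ` (a relation BETWEEN two limits along `γ ∘ s`, `γ ∘ s'`, which no lemma on
  `Spacetime.SubconvergesLocallyTo` supplies); `KerrDocParamClosedOn 𝓢 O` (C) — the sub-extremal Kerr parameters of a region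
  are closed under `ε`-approximation, itself reduced to uniqueness up to the sign of `a` (U, `KerrDocParamUniqueOn`) and the
  spin flip (S, `KerrDocSpinFlipOn`) by real-variable bookkeeping (`kerrDocParamClosedOn_of_unique_of_flip`);
  `kerrLocusClopen_of_transport_of_paramClosed` — K's text from (T) ∧ (C); and `opennessTransportAlong_of_hullTopology_of_pinned`
  — (T) is an OUTPUT of §2 (every element is exactly Kerr with the witness's parameters, hence window-close at every size by
  `isExteriorWindowClose_of_isKerrDoc'`), so §2 refines §3 and (C) is not needed on that route.

What is NOT here (the four inputs K still owes, lead's notes B1–B4): the pointed-`C²_loc` topology on `Ω_γ` and its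
connectedness (needs a Hausdorff ambient space of pointed triples — limits are determined only up to trimming,
`SubconvergesLocallyTo.restrict'`), closedness of Kerr loci (horizon lineage + no degeneration; the curvature half is in the
companion file `…RHorizonHullCurvature.lean`), the neighbourhood property of window closeness (pointed `C²` convergence on
the compact closure of the window + doc-semicontinuity), and the pinning budget (area theorem for `horizonOf 𝒟`).
No stub of the line is restated as a definition; K's text appears only as the conclusion of theorems.

References: Hale 1980, Ch. I §8, Lemma 8.1 / Thm. 8.1 [Hale1980]; Dafermos–Luk 2017, §1.2.1 and Conjecture 1
[DafermosLuk2017]; Chruściel–Delay–Galloway–Howard 2001, Thm. 1.1 (area theorem) [ChruscielEtAl2001].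
-/

noncomputable section

-- the operator-norm instance on `E4 →L[ℝ] E4 →L[ℝ] ℝ` needs one more level of pending
-- instance problems than the default (as in `PhotonSphereChannelsTameHullDefs.lean`)
set_option maxSynthPendingDepth 3
-- every `Summit.FinalStateConjecture.FinalStateConjecture.…` name repeats the summit = sub-problem segment (D-0017 layout)
set_option linter.dupNamespace false

open Set Filter Function TopologicalSpace Manifold Bundle
open scoped Topology Manifold ContDiff ENNReal NNReal

namespace Summit.FinalStateConjecture.FinalStateConjecture.Theorems.DarkFuture

open Literature.Geometry.Lorentzian
open Summit.FinalStateConjecture.FinalStateConjecture.Theorems.TameHull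

/-! ### §0 The Kerr witness meets every window hypothesis -/

/-- **An exactly-Kerr d.o.c. contains exterior windows of every size `0`-close (hence `δ`-close, `0 ≤ δ`) to Kerr with its
own parameters**: restrict the isometric chart of `IsKerrDoc` to the window (the witness side of K: the Kerr element itself
meets the window hypothesis of `WindowIsolationAlong` at every `(W, η, δ)`; primed name — the trimming file of stub P′ carries
the unprimed one). [cite: DafermosLuk2017, §1.2.1] -/
theorem isExteriorWindowClose_of_isKerrDoc' : ∀ {𝓢 : Spacetime.{0} 4} {E : EndDatum 𝓢} {M a : ℝ}, IsKerrDoc 𝓢 E.doc M a → ∀ (W η : ℝ) {δ : ℝ}, 0 ≤ δ → IsExteriorWindowClose 𝓢 E M a W η δ := by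
  intro 𝓢 E M a h W η δ _hδ
  obtain ⟨Ψ, hinj, hsmooth, hrange, hdev, hfut⟩ := h
  refine ⟨Ψ, hsmooth.contMDiffOn, hinj.injOn, fun x _ ↦ hrange ▸ mem_range_self x, ?_, fun x _ hx ↦ hfut x hx⟩
  rw [deviationExtend_eq_zero hdev, supCkENorm_zero]
  exact zero_le

section Along

variable {X : Type} [TopologicalSpace X] [ChartedSpace E3 X] [IsManifold (𝓡 3) ∞ X] [ConnectedSpace X]
  {D : InitialDataSet (𝓡 3) X}

/-! ### §1 The based hull `Ω_γ` as a type; the typed inputs (B1–B3) hull topology and (B4) pinning -/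

/-- **The based hull `Ω_γ` as a type**: horizon-hull elements `(𝓢, E, p)` of the development `𝒟` in the class `(Λ, r₀)`
along the horizon generator path `γ` (`TameHull.IsHorizonHullElement`). [cite: Hale1980, Ch. I §8] -/
structure HullElt (𝒟 : VacuumCauchyDevelopment D) [𝒟.metric.HasLeviCivita] (Λ : ℕ → ℝ≥0) (r₀ : ℝ)
    (γ : ℝ → 𝒟.carrier) where
  /-- The limit spacetime. -/
  𝓢 : Spacetime.{0} 4
  /-- Its end datum. -/
  E : EndDatum 𝓢
  /-- The base point (on `E.horizon`). -/
  p : 𝓢.carrier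
  /-- `(𝓢, E, p)` is a horizon-hull element along `γ`. -/
  mem : IsHorizonHullElement 𝒟 Λ r₀ γ 𝓢 E p

/-- **(B1–B3) `HullTopologyAlong 𝒟 Λ r₀ γ` — a hull topology along `γ`.** There is a topology on `Ω_γ = HullElt 𝒟 Λ r₀ γ`
(intended: the pointed `C²_loc` topology, limits along `γ ∘ s`) which is (B1) PRECONNECTED (`s ↦ (𝒟, γ s)` is continuous and
`Ω_γ` is an ω-limit set — Hale 1980, Ch. I §8, Lemma 8.1), in which (B2) every sub-extremal Kerr locus
`{Z | IsKerrDoc Z.𝓢 Z.E.doc M a}` is CLOSED (limits of exactly-Kerr d.o.c.s based on their horizons are exactly Kerr with the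
same parameters), and in which (B3) for every sub-extremal `(M, a)` and window size `(W, η, δ)`, `0 < η`, `0 < δ`, the set of
elements containing an exterior window `(W, η, δ)`-close to Kerr `(M, a)` is a NEIGHBOURHOOD of every exactly-Kerr-`(M, a)`
element (pointed `C²` convergence on the compact closure of the window + doc-semicontinuity). A predicate on
`(𝒟, Λ, r₀, γ)`; no instance is asserted here. [cite: Hale1980, Ch. I §8 Thm. 8.1] -/
def HullTopologyAlong (𝒟 : VacuumCauchyDevelopment D) [𝒟.metric.HasLeviCivita] (Λ : ℕ → ℝ≥0) (r₀ : ℝ)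
    (γ : ℝ → 𝒟.carrier) : Prop :=
  ∃ τ : TopologicalSpace (HullElt 𝒟 Λ r₀ γ),
    @PreconnectedSpace (HullElt 𝒟 Λ r₀ γ) τ ∧
    (∀ M a : ℝ, 0 < M → |a| < M → IsClosed[τ] {Z : HullElt 𝒟 Λ r₀ γ | IsKerrDoc Z.𝓢 Z.E.doc M a}) ∧
    ∀ M a : ℝ, 0 < M → |a| < M → ∀ W η δ : ℝ, 0 < η → 0 < δ →
      ∀ Z : HullElt 𝒟 Λ r₀ γ, IsKerrDoc Z.𝓢 Z.E.doc M a →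
        {Z' : HullElt 𝒟 Λ r₀ γ | IsExteriorWindowClose Z'.𝓢 Z'.E M a W η δ} ∈ @nhds (HullElt 𝒟 Λ r₀ γ) τ Z

/-- **(B4) `KerrParametersPinnedAlong 𝒟 Λ r₀ γ` — pinning along `γ`.** The sub-extremal parameters `(M, a)` realised as
exact Kerr d.o.c.s of horizon-hull elements along `γ` form a FINITE set (intended: the horizon area along `γ` is monotone —
area theorem for `horizonOf 𝒟` under complete `𝓘⁺` — hence constant on limits, and the hole's mass has bounded variation, so
`(M, |a|)` is determined by `γ`; with the sign of `a`, at most two values). Topology-free predicate on `(𝒟, Λ, r₀, γ)`.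
[cite: ChruscielEtAl2001, Thm 1.1] -/
def KerrParametersPinnedAlong (𝒟 : VacuumCauchyDevelopment D) [𝒟.metric.HasLeviCivita] (Λ : ℕ → ℝ≥0) (r₀ : ℝ)
    (γ : ℝ → 𝒟.carrier) : Prop :=
  ∃ F : Set (ℝ × ℝ), F.Finite ∧ ∀ M a : ℝ, 0 < M → |a| < M →
    ∀ (𝓢 : Spacetime.{0} 4) (E : EndDatum 𝓢) (p : 𝓢.carrier),
      IsHorizonHullElement 𝒟 Λ r₀ γ 𝓢 E p → IsKerrDoc 𝓢 E.doc M a → (M, a) ∈ F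

/-! ### §2 K from (B1–B4): every element of `Ω_γ` is Kerr with the witness's parameters -/

/-- **Reduction of K for ONE development, ONE path and the witness's OWN parameters**: hull topology (B1–B3) + pinning (B4)
+ window isolation along generators + ONE horizon-hull element along `γ` with d.o.c. exactly Kerr `(M, a)` (sub-extremal)
⇒ EVERY horizon-hull element along `γ` has d.o.c. exactly Kerr `(M, a)` — `HullTopology.subset_locus_of_finitePinning` with
`Ω = univ`, `P = ℝ × ℝ` (sub-extremal pairs admissible), loci = exact-Kerr-d.o.c. elements, closeness sets =
exterior-window-close elements indexed by `(W, η, δ)` with `0 < η`, `0 < δ`. [cite: Hale1980, Ch. I §8 Thm. 8.1] -/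
theorem isKerrDoc_along_of_hullTopology {𝒟 : VacuumCauchyDevelopment D} [𝒟.metric.HasLeviCivita]
    {Λ : ℕ → ℝ≥0} {r₀ : ℝ} {γ : ℝ → 𝒟.carrier} (hγ : IsHorizonPath 𝒟 γ)
    (htop : HullTopologyAlong 𝒟 Λ r₀ γ) (hpin : KerrParametersPinnedAlong 𝒟 Λ r₀ γ)
    (hiso : WindowIsolationAlong 𝒟 Λ r₀) {M a : ℝ} (hM : 0 < M) (ha : |a| < M)
    {𝓢₀ : Spacetime.{0} 4} {E₀ : EndDatum 𝓢₀} {p₀ : 𝓢₀.carrier} (hZ₀ : IsHorizonHullElement 𝒟 Λ r₀ γ 𝓢₀ E₀ p₀)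
    (hkerr₀ : IsKerrDoc 𝓢₀ E₀.doc M a) :
    ∀ (𝓢 : Spacetime.{0} 4) (E : EndDatum 𝓢) (p : 𝓢.carrier),
      IsHorizonHullElement 𝒟 Λ r₀ γ 𝓢 E p → IsKerrDoc 𝓢 E.doc M a := by
  obtain ⟨τ, hconn, hclosedK, hnhdK⟩ := htop
  letI : TopologicalSpace (HullElt 𝒟 Λ r₀ γ) := τ
  haveI : PreconnectedSpace (HullElt 𝒟 Λ r₀ γ) := hconn
  -- the abstract data
  let Adm : ℝ × ℝ → Prop := fun q ↦ 0 < q.1 ∧ |q.2| < q.1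
  let locus : ℝ × ℝ → Set (HullElt 𝒟 Λ r₀ γ) := fun q ↦ {Z | IsKerrDoc Z.𝓢 Z.E.doc q.1 q.2}
  let close : ℝ × ℝ → {w : ℝ × ℝ × ℝ // 0 < w.2.1 ∧ 0 < w.2.2} → Set (HullElt 𝒟 Λ r₀ γ) :=
    fun q w ↦ {Z | IsExteriorWindowClose Z.𝓢 Z.E q.1 q.2 w.1.1 w.1.2.1 w.1.2.2}
  have hΩ : IsPreconnected (univ : Set (HullElt 𝒟 Λ r₀ γ)) := isPreconnected_univ
  have hall : (univ : Set (HullElt 𝒟 Λ r₀ γ)) ⊆ locus (M, a) := by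
    refine HullTopology.subset_locus_of_finitePinning hΩ Adm locus close (M, a) ⟨hM, ha⟩ ?_ ?_ ?_ ?_ ?_
    · -- (B2) closed locus
      intro Z _ hZ
      rw [inter_univ, (hclosedK M a hM ha).closure_eq] at hZ
      exact hZ
    · -- (B3) closeness sets are neighbourhoods of Kerr elements
      rintro ⟨⟨W, η, δ⟩, hη, hδ⟩ Z ⟨hZ, -⟩
      rw [nhdsWithin_univ]
      exact hnhdK M a hM ha W η δ hη hδ Z hZ
    · -- (iso) window isolation along generators at `(M, a)`
      intro ε hε
      obtain ⟨W, η, δ, hη, hδ, H⟩ := hiso γ hγ M a hM ha ε hε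
      refine ⟨⟨(W, η, δ), hη, hδ⟩, fun Z _ hZ ↦ ?_⟩
      obtain ⟨M', a', hM', ha', hnear, hkerr'⟩ := H Z.𝓢 Z.E Z.p Z.mem hZ
      refine ⟨(M', a'), ⟨hM', ha'⟩, ?_, hkerr'⟩
      rw [Prod.dist_eq, Real.dist_eq, Real.dist_eq]
      exact max_le ((le_add_of_nonneg_right (abs_nonneg _)).trans hnear)
        ((le_add_of_nonneg_left (abs_nonneg _)).trans hnear)
    · -- (B4) pinning
      obtain ⟨F, hF, hpinF⟩ := hpin
      refine ⟨F, hF, fun q hq ⟨Z, hZ, _⟩ ↦ ?_⟩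
      exact hpinF q.1 q.2 hq.1 hq.2 Z.𝓢 Z.E Z.p Z.mem hZ
    · -- the witness
      exact ⟨⟨𝓢₀, E₀, p₀, hZ₀⟩, hkerr₀, mem_univ _⟩
  intro 𝓢 E p hZ
  exact hall (mem_univ (⟨𝓢, E, p, hZ⟩ : HullElt 𝒟 Λ r₀ γ))

end Along

/-- **K's quantifier shape along `γ`, for one development** (registered sub-goal of stub K): (B1–B3) hull topology + (B4)
pinning along `γ` + window isolation along generators + SOME exactly-Kerr sub-extremal horizon-hull element along `γ` ⇒ ONE
sub-extremal `(M, a)` for ALL horizon-hull elements along `γ` (namely the witness's). [cite: Hale1980, Ch. I §8 Thm. 8.1] -/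
theorem kerrLocus_along_of_hullTopology_of_pinned : ∀ {X : Type} [TopologicalSpace X] [ChartedSpace E3 X] [IsManifold (𝓡 3) ∞ X] [ConnectedSpace X] {D : InitialDataSet (𝓡 3) X} {𝒟 : VacuumCauchyDevelopment D} [𝒟.metric.HasLeviCivita] {Λ : ℕ → ℝ≥0} {r₀ : ℝ} {γ : ℝ → 𝒟.carrier}, IsHorizonPath 𝒟 γ → HullTopologyAlong 𝒟 Λ r₀ γ → KerrParametersPinnedAlong 𝒟 Λ r₀ γ → WindowIsolationAlong 𝒟 Λ r₀ → (∃ (𝓢 : Spacetime.{0} 4) (E : EndDatum 𝓢) (p : 𝓢.carrier), IsHorizonHullElement 𝒟 Λ r₀ γ 𝓢 E p ∧ ∃ M a : ℝ, 0 < M ∧ |a| < M ∧ IsKerrDoc 𝓢 E.doc M a) → ∃ M a : ℝ, 0 < M ∧ |a| < M ∧ ∀ (𝓢 : Spacetime.{0} 4) (E : EndDatum 𝓢) (p : 𝓢.carrier), IsHorizonHullElement 𝒟 Λ r₀ γ 𝓢 E p → IsKerrDoc 𝓢 E.doc M a := by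
  intro X _ _ _ _ D 𝒟 _ Λ r₀ γ hγ htop hpin hiso hwit
  obtain ⟨𝓢₀, E₀, p₀, hZ₀, M₀, a₀, hM₀, ha₀, hkerr₀⟩ := hwit
  exact ⟨M₀, a₀, hM₀, ha₀, isKerrDoc_along_of_hullTopology hγ htop hpin hiso hM₀ ha₀ hZ₀ hkerr₀⟩

/-- **Reduction of stub K to (B1–B4)** (registered sub-goal of stub K; K's registered text VERBATIM as the conclusion): if
every development as in Φ, every class `(Λ, r₀)` with `0 < r₀` and precompact generator hull, and every horizon generator
path carry a hull topology (B1–B3) and pinning (B4) along the path, then `KerrLocusClopen` holds (`GeneratorHullExists`,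
`DevHyp`, `0 < r₀`, admissibility are handed to the producers of (B1)–(B4), not consumed by the logic).
[cite: Hale1980, Ch. I §8 Thm. 8.1] -/
theorem kerrLocusClopen_of_hullTopology_of_pinned : (∀ {X : Type} [TopologicalSpace X] [ChartedSpace E3 X] [IsManifold (𝓡 3) ∞ X] [T2Space X] [SecondCountableTopology X] [ConnectedSpace X] {D : InitialDataSet (𝓡 3) X}, D ∈ admissibleVacuumData X → ∀ (𝒟 : VacuumCauchyDevelopment D) [𝒟.metric.HasLeviCivita], DevHyp 𝒟 → ∀ (Λ : ℕ → ℝ≥0) (r₀ : ℝ), 0 < r₀ → GeneratorHullExists 𝒟 Λ r₀ → ∀ γ : ℝ → 𝒟.carrier, IsHorizonPath 𝒟 γ → HullTopologyAlong 𝒟 Λ r₀ γ ∧ KerrParametersPinnedAlong 𝒟 Λ r₀ γ) → ∀ (X : Type) [TopologicalSpace X] [ChartedSpace E3 X] [IsManifold (𝓡 3) ∞ X] [T2Space X] [SecondCountableTopology X] [ConnectedSpace X], ∀ D ∈ admissibleVacuumData X, ∀ (𝒟 : VacuumCauchyDevelopment D) [𝒟.metric.HasLeviCivita], DevHyp 𝒟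 → ∀ (Λ : ℕ → ℝ≥0) (r₀ : ℝ), 0 < r₀ → GeneratorHullExists 𝒟 Λ r₀ → WindowIsolationAlong 𝒟 Λ r₀ → ∀ γ : ℝ → 𝒟.carrier, IsHorizonPath 𝒟 γ → (∃ (𝓢 : Spacetime.{0} 4) (E : EndDatum 𝓢) (p : 𝓢.carrier), IsHorizonHullElement 𝒟 Λ r₀ γ 𝓢 E p ∧ ∃ M a : ℝ, 0 < M ∧ |a| < M ∧ IsKerrDoc 𝓢 E.doc M a) → ∃ M a : ℝ, 0 < M ∧ |a| < M ∧ ∀ (𝓢 : Spacetime.{0} 4) (E : EndDatum 𝓢) (p : 𝓢.carrier), IsHorizonHullElement 𝒟 Λ r₀ γ 𝓢 E p → IsKerrDoc 𝓢 E.doc M a := by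
  intro hB X _ _ _ _ _ _ D hD 𝒟 _ hdev Λ r₀ hr₀ hgen hiso γ hγ hwit
  obtain ⟨htop, hpin⟩ := hB hD 𝒟 hdev Λ r₀ hr₀ hgen γ hγ
  exact kerrLocus_along_of_hullTopology_of_pinned hγ htop hpin hiso hwit

/-! ### §3 The minimal gap of the pure-logic attempt: openness transport (T) and parameter closedness (C) -/

section Transport

variable {X : Type} [TopologicalSpace X] [ChartedSpace E3 X] [IsManifold (𝓡 3) ∞ X] [ConnectedSpace X]
  {D : InitialDataSet (𝓡 3) X}

/-- **(T) `OpennessTransportAlong 𝒟 Λ r₀ γ` — transport of window-closeness between two limits along `γ`** (obstruction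
goal 1 of the pure-logic attempt on K, universally closed): if SOME horizon-hull element along `γ` has d.o.c. exactly Kerr
`(M, a)` (sub-extremal), then EVERY horizon-hull element along `γ` contains, for every window size `(W, η, δ)`, `0 < η`,
`0 < δ`, an exterior window `(W, η, δ)`-close to Kerr `(M, a)` inside its d.o.c. This relates limits along `γ ∘ s` and
`γ ∘ s'` for DIFFERENT sequences; no lemma about `Spacetime.SubconvergesLocallyTo` (refl/subseq/mono/restrict/trans/rebase/
diag/ofTendsto/of_isometry) supplies it — it is the clopen argument of §2 in disguise (`opennessTransportAlong_of_hullTopology_of_pinned`).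
[cite: DafermosLuk2017, §1.2.1] -/
def OpennessTransportAlong (𝒟 : VacuumCauchyDevelopment D) [𝒟.metric.HasLeviCivita] (Λ : ℕ → ℝ≥0) (r₀ : ℝ)
    (γ : ℝ → 𝒟.carrier) : Prop :=
  ∀ M a : ℝ, 0 < M → |a| < M →
    ∀ (𝓢₀ : Spacetime.{0} 4) (E₀ : EndDatum 𝓢₀) (p₀ : 𝓢₀.carrier),
      IsHorizonHullElement 𝒟 Λ r₀ γ 𝓢₀ E₀ p₀ → IsKerrDoc 𝓢₀ E₀.doc M a →
        ∀ (𝓢 : Spacetime.{0} 4) (E : EndDatum 𝓢) (p : 𝓢.carrier), IsHorizonHullElement 𝒟 Λ r₀ γ 𝓢 E p →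
          ∀ W η δ : ℝ, 0 < η → 0 < δ → IsExteriorWindowClose 𝓢 E M a W η δ

omit [TopologicalSpace X] [ChartedSpace E3 X] [IsManifold (𝓡 3) ∞ X] [ConnectedSpace X] in
/-- **(C) `KerrDocParamClosedOn 𝓢 O` — the sub-extremal Kerr parameters of the region `O ⊆ 𝓢` are closed under
approximation** (obstruction goal 2, universally closed): if for every `ε > 0` the region is an exact Kerr `(M', a')` exterior
for some sub-extremal `(M', a')` with `|M' − M| + |a' − a| ≤ ε`, and `(M, a)` is sub-extremal, then `O` is an exact Kerr
`(M, a)` exterior. [cite: DafermosLuk2017, Conjecture 1] -/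
def KerrDocParamClosedOn (𝓢 : Spacetime.{0} 4) (O : Set 𝓢.carrier) : Prop :=
  ∀ M a : ℝ, 0 < M → |a| < M →
    (∀ ε > (0 : ℝ), ∃ M' a' : ℝ, 0 < M' ∧ |a'| < M' ∧ |M' - M| + |a' - a| ≤ ε ∧ IsKerrDoc 𝓢 O M' a') →
      IsKerrDoc 𝓢 O M a

omit [TopologicalSpace X] [ChartedSpace E3 X] [IsManifold (𝓡 3) ∞ X] [ConnectedSpace X] in
/-- **(U) `KerrDocParamUniqueOn 𝓢 O` — the sub-extremal Kerr parameters of the region `O` are unique up to the sign of `a`**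
(mass and |angular momentum| are isometry invariants of a sub-extremal Kerr exterior; not in the tree).
[cite: DafermosLuk2017, Conjecture 1] -/
def KerrDocParamUniqueOn (𝓢 : Spacetime.{0} 4) (O : Set 𝓢.carrier) : Prop :=
  ∀ M a M' a' : ℝ, 0 < M → |a| < M → 0 < M' → |a'| < M' →
    IsKerrDoc 𝓢 O M a → IsKerrDoc 𝓢 O M' a' → M' = M ∧ |a'| = |a|

omit [TopologicalSpace X] [ChartedSpace E3 X] [IsManifold (𝓡 3) ∞ X] [ConnectedSpace X] in
/-- **(S) `KerrDocSpinFlipOn 𝓢 O` — the spin flip on the region `O`**: an exact Kerr `(M, a)` region is an exact Kerr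
`(M, −a)` region (the reflection isometry `(t*, x, y, z) ↦ (t*, x, −y, z)` of the ingoing Kerr–Schild form, time-orientation
preserving; a computation with `Kerr.bilin`, not in the tree). [cite: DafermosLuk2017, Conjecture 1] -/
def KerrDocSpinFlipOn (𝓢 : Spacetime.{0} 4) (O : Set 𝓢.carrier) : Prop :=
  ∀ M a : ℝ, IsKerrDoc 𝓢 O M a → IsKerrDoc 𝓢 O M (-a)

omit [TopologicalSpace X] [ChartedSpace E3 X] [IsManifold (𝓡 3) ∞ X] [ConnectedSpace X] in
/-- **(C) ⇐ (U) ∧ (S)** (real-variable bookkeeping): approximating sub-extremal Kerr parameters of one region agree up to the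
sign of `a` by (U), so they equal `(M, ±a)`, and (S) flips the sign. [folklore] -/
theorem kerrDocParamClosedOn_of_unique_of_flip {𝓢 : Spacetime.{0} 4} {O : Set 𝓢.carrier}
    (hU : KerrDocParamUniqueOn 𝓢 O) (hS : KerrDocSpinFlipOn 𝓢 O) : KerrDocParamClosedOn 𝓢 O := by
  intro M a hM ha h
  obtain ⟨M₁, a₁, hM₁, ha₁, -, hk₁⟩ := h 1 one_pos
  have hMM : M₁ = M := by
    by_contra hne
    have hpos : 0 < |M₁ - M| / 2 := half_pos (abs_pos.2 (sub_ne_zero.2 hne))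
    obtain ⟨M₂, a₂, hM₂, ha₂, hnear, hk₂⟩ := h _ hpos
    obtain ⟨h21, -⟩ := hU M₁ a₁ M₂ a₂ hM₁ ha₁ hM₂ ha₂ hk₁ hk₂
    have h1 : |M₁ - M| ≤ |M₁ - M| / 2 :=
      calc |M₁ - M| = |M₂ - M| := by rw [h21]
        _ ≤ |M₂ - M| + |a₂ - a| := le_add_of_nonneg_right (abs_nonneg _)
        _ ≤ |M₁ - M| / 2 := hnear
    linarith [abs_pos.2 (sub_ne_zero.2 hne)]
  have haa : |a₁| = |a| := by
    by_contra hne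
    have hpos : 0 < |(|a₁| - |a|)| / 2 := half_pos (abs_pos.2 (sub_ne_zero.2 hne))
    obtain ⟨M₂, a₂, hM₂, ha₂, hnear, hk₂⟩ := h _ hpos
    obtain ⟨-, h21⟩ := hU M₁ a₁ M₂ a₂ hM₁ ha₁ hM₂ ha₂ hk₁ hk₂
    have h1 : |(|a₁| - |a|)| ≤ |a₂ - a| := by
      rw [← h21]
      exact abs_abs_sub_abs_le_abs_sub a₂ a
    have h2 : |a₂ - a| ≤ |(|a₁| - |a|)| / 2 := (le_add_of_nonneg_left (abs_nonneg _)).trans hnear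
    linarith [abs_pos.2 (sub_ne_zero.2 hne)]
  subst hMM
  rcases abs_eq_abs.1 haa with h' | h'
  · subst h'
    exact hk₁
  · have hk := hS M₁ a₁ hk₁
    rw [h', neg_neg] at hk
    exact hk

/-- **§2 refines §3: (B1–B4) + window isolation give the transport (T) along `γ`** (every element is EXACTLY Kerr with the
witness's parameters by `isKerrDoc_along_of_hullTopology`, hence window-close at every size by
`isExteriorWindowClose_of_isKerrDoc'`) — so (T) is the output of the clopen argument, not an independent input, and (C) is
not needed on that route. [cite: Hale1980, Ch. I §8 Thm. 8.1] -/
theorem opennessTransportAlong_of_hullTopology_of_pinned {𝒟 : VacuumCauchyDevelopment D} [𝒟.metric.HasLeviCivita]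
    {Λ : ℕ → ℝ≥0} {r₀ : ℝ} {γ : ℝ → 𝒟.carrier} (hγ : IsHorizonPath 𝒟 γ)
    (htop : HullTopologyAlong 𝒟 Λ r₀ γ) (hpin : KerrParametersPinnedAlong 𝒟 Λ r₀ γ)
    (hiso : WindowIsolationAlong 𝒟 Λ r₀) : OpennessTransportAlong 𝒟 Λ r₀ γ := by
  intro M a hM ha 𝓢₀ E₀ p₀ hZ₀ hkerr₀ 𝓢 E p hZ W η δ _ hδ
  exact isExteriorWindowClose_of_isKerrDoc'
    (isKerrDoc_along_of_hullTopology hγ htop hpin hiso hM ha hZ₀ hkerr₀ 𝓢 E p hZ) W η hδ.le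

end Transport

/-- **Reduction of stub K to (T) ∧ (C)** (registered sub-goal of stub K; K's registered text VERBATIM as the conclusion;
the minimal gap of the pure-logic attempt): take the witness's parameters `(M₀, a₀)`; for an arbitrary element and every
`ε > 0`, window isolation at `(M₀, a₀, ε)` returns a window size, (T) supplies the window in the element, isolation returns
exact Kerr with `ε`-near sub-extremal parameters, and (C) on `E.doc` passes to `(M₀, a₀)`. Pure logic.
[cite: Hale1980, Ch. I §8 Thm. 8.1] -/
theorem kerrLocusClopen_of_transport_of_paramClosed : (∀ {X : Type} [TopologicalSpace X] [ChartedSpace E3 X] [IsManifold (𝓡 3) ∞ X] [T2Space X] [SecondCountableTopology X] [ConnectedSpace X] {D : InitialDataSet (𝓡 3) X}, D ∈ admissibleVacuumData X → ∀ (𝒟 : VacuumCauchyDevelopment D) [𝒟.metric.HasLeviCivita], DevHyp 𝒟 → ∀ (Λ : ℕ → ℝ≥0) (r₀ : ℝ), 0 < r₀ → GeneratorHullExists 𝒟 Λ r₀ → ∀ γ : ℝ → 𝒟.carrier, IsHorizonPath 𝒟 γ → OpennessTransportAlong 𝒟 Λ r₀ γ) → (∀ (𝓢 : Spacetime.{0}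 4) (E : EndDatum 𝓢), KerrDocParamClosedOn 𝓢 E.doc) → ∀ (X : Type) [TopologicalSpace X] [ChartedSpace E3 X] [IsManifold (𝓡 3) ∞ X] [T2Space X] [SecondCountableTopology X] [ConnectedSpace X], ∀ D ∈ admissibleVacuumData X, ∀ (𝒟 : VacuumCauchyDevelopment D) [𝒟.metric.HasLeviCivita], DevHyp 𝒟 → ∀ (Λ : ℕ → ℝ≥0) (r₀ : ℝ), 0 < r₀ → GeneratorHullExists 𝒟 Λ r₀ → WindowIsolationAlong 𝒟 Λ r₀ → ∀ γ : ℝ → 𝒟.carrier, IsHorizonPath 𝒟 γ → (∃ (𝓢 : Spacetime.{0} 4) (E : EndDatum 𝓢) (p : 𝓢.carrier), IsHorizonHullElement 𝒟 Λ r₀ γ 𝓢 E p ∧ ∃ M a : ℝ, 0 < M ∧ |a| < M ∧ IsKerrDoc 𝓢 E.doc M a) → ∃ M a : ℝ, 0 < M ∧ |a| < M ∧ ∀ (𝓢 : Spacetime.{0} 4) (E : EndDatum 𝓢) (p : 𝓢.carrier), IsHorizonHullElement 𝒟 Λ r₀ γ 𝓢 E p → IsKerrDoc 𝓢 E.doc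 M a := by
  intro hT hC X _ _ _ _ _ _ D hD 𝒟 _ hdev Λ r₀ hr₀ hgen hiso γ hγ hwit
  obtain ⟨𝓢₀, E₀, p₀, hZ₀, M₀, a₀, hM₀, ha₀, hkerr₀⟩ := hwit
  refine ⟨M₀, a₀, hM₀, ha₀, fun 𝓢 E p hZ ↦ hC 𝓢 E M₀ a₀ hM₀ ha₀ fun ε hε ↦ ?_⟩
  obtain ⟨W, η, δ, hη, hδ, H⟩ := hiso γ hγ M₀ a₀ hM₀ ha₀ ε hε
  exact H 𝓢 E p hZ (hT hD 𝒟 hdev Λ r₀ hr₀ hgen γ hγ M₀ a₀ hM₀ ha₀ 𝓢₀ E₀ p₀ hZ₀ hkerr₀ 𝓢 E p hZ W η δ hη hδ)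

end Summit.FinalStateConjecture.FinalStateConjecture.Theorems.DarkFuture

end
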